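import Mathlib.Analysis.SpecialFunctions.Pow.Real
import Literature.Computability.AlgebraicComplexity.OneSliceSpeedup
import Literature.Computability.AlgebraicComplexity.MatMulDirectSumCubicFormat
import Literature.Computability.AlgebraicComplexity.AsymptoticSpectrumDuality
import Literature.Computability.AlgebraicComplexity.CoppersmithWinograd1982
import Literature.Computability.AlgebraicComplexity.BorderRankRestriction
import HarnessLib

/-!
# The asymptotic sum inequality is strict: `∑ᵢ (kᵢmᵢnᵢ)^{ω/3} < bR(⊕ᵢ⟨kᵢ,mᵢ,nᵢ⟩)` ("`ω` is an infimum, not a minimum"; Coppersmith–Winograd 1982, Strassen 1988)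

Topic `Literature/Computability/AlgebraicComplexity`. PROVED, over every field `K`, for the algebraic
border rank `algBorderRank` over `K[ε]` and the tree's `omega K`:

* `sum_rpow_omega_div_three_lt_algBorderRank_matMulDirectSum` — if every block of
  `D = ⊕ᵢ ⟨kᵢ,mᵢ,nᵢ⟩` has positive dimensions and some block is not `⟨1,1,1⟩`, then
  `∑ᵢ (kᵢmᵢnᵢ)^{ω/3} < bR(D)` (Bürgisser–Clausen–Shokrollahi 1997, §15.13 Notes, p. 455: "in the
  conclusion of the asymptotic sum inequality one always has strict inequality, unless … `eᵢ = hᵢ = ℓᵢ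
  = 1` for all `i`"; Landsberg 2017, Thm. 3.3.3.5 [CW82]; Alman–Li 2026, Cor. 6.1: "`bR(T) ≤ r`, `r > n`
  `⟹ R̃(T) < r` … first established by Strassen [Str88]").

## Proof

Suppose `S(D) := ∑ᵢ (kᵢmᵢnᵢ)^{ω/3} = bR(D) =: r` (by Schönhage's `τ`-theorem `S(D) ≤ r`,
`asymptoticSumInequality_algBorderRank`). By the flattening bounds `r ≥ A, B, C` (the three
dimensions `∑kᵢmᵢ, ∑mᵢnᵢ, ∑kᵢnᵢ`).
* If `r = A = B = C` (cubic format, minimal border rank), `D` is trivial by Coppersmith–Winograd's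
  Rem. 6.2 (`MatMulDirectSumCubicFormat.lean`), contradicting the hypothesis.
* Otherwise `ABC < r³`. The symmetrisation `D₃` (blocks `⟨kᵢmⱼnₗ, mᵢnⱼkₗ, nᵢkⱼmₗ⟩`) is a restriction
  of `D ⊗ D' ⊗ D''` (`D', D''` the sums with cyclically permuted formats, `bR(D') , bR(D'') ≤ bR(D)` by
  rotation), so `bR(D₃) ≤ r³ = S(D)³ = S(D₃) ≤ bR(D₃)`: `D₃` is again tight, and all three of its
  dimensions equal `ABC < bR(D₃)`. The **engine** `false_of_tight` then derives a contradiction for a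
  tight sum `𝐃` whose three dimensions are `< ρ = bR(𝐃)`: pass to the direct sum `𝐓` of the words of
  length `N` (`bR(𝐓) = S(𝐓) = ρᴺ`, dimensions `dᴺ`, and `ρᴺ > d_κᴺ + d_μᴺ`, `ρᴺ > d_ιᴺ` for `N` large);
  the one-slice speedup (`OneSliceSpeedup.lean`) gives `𝐓 ⊕ ⟨1,ρᴺ,1⟩ ⊴ ⟨ρᴺ⟩ ⊕ ⟨1, d_κᴺ+d_μᴺ, 1⟩`;
  take a universal spectral point `F` with `F(𝐓) = R̃(𝐓)` (Strassen duality,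
  `strassen_duality_asymptoticRank_holds`); `R̃(𝐓) ≥ S(𝐓) = ρᴺ` (the `τ`-theorem for the rank, on words
  of `𝐓`) and `F ≤ bR` give `F(𝐓) = ρᴺ`, so monotonicity of `F` under degeneration
  (`DegenerationSpectralMonotone.lean`) yields `g(ρᴺ) ≤ g(d_κᴺ + d_μᴺ)` for `g(n) := F(⟨1,n,1⟩)`, a
  multiplicative monotone function with `g(1) = 1`; hence `g ≡ 1`, `F(⟨a,b,c⟩) = F(⟨a,1,c⟩) ≤ ac`, and
  `ρᴺ = F(𝐓) ≤ ∑_w K_w N_w = d_ιᴺ < ρᴺ` — contradiction (the "three directions / Strassen calculus"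
  argument of Alman–Li 2026, Prop. 4.4 and Thm. 6.1, for one direction and a direct sum of matrix tensors).

## References

* P. Bürgisser, M. Clausen, M. A. Shokrollahi, *Algebraic Complexity Theory*, Springer 1997, §15.13
  Notes, pp. 455, 457 (held). [BurgisserClausenShokrollahi1997]
* J. M. Landsberg, *Geometry and Complexity Theory*, CUP 2017, Thm. 3.3.3.5 (held). [Landsberg2017]
* V. Strassen, *The asymptotic spectrum of tensors*, J. reine angew. Math. 384 (1988) 102–152.
  [Strassen1988]
* J. Alman, B. Li, *Asymptotic Rank Speedup Theorems, Revisited*, arXiv:2605.21738 (2026), Prop. 4.4,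
  Thm. 6.1, Cor. 6.1 (held). [AlmanLi2026]
* D. Coppersmith, S. Winograd, *On the asymptotic complexity of matrix multiplication*, SIAM J.
  Comput. 11 (1982) 472–492 (primary source; not held). [CoppersmithWinograd1982]
-/

noncomputable section

open scoped BigOperators Polynomial
open Filter

namespace Literature.Computability.AlgebraicComplexity

universe u

/-! ## One-slice values of a universal spectral point -/

section OneSliceValues

variable {K : Type u} [Field K] {F : SpectralMap K} (hF : IsUniversalSpectralPoint K F)
include hF

/-- `F(oneSlice σ) = F(oneSlice τ)` for equinumerous `σ, τ` (relabelling). [folklore] -/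
theorem IsUniversalSpectralPoint.oneSlice_congr {σ τ : Type} [Fintype σ] [Fintype τ] [DecidableEq σ]
    [DecidableEq τ] (e : τ ≃ σ) : F (oneSliceTensor K σ) = F (oneSliceTensor K τ) := by
  have hστ : TensorRestrictsTo (oneSliceTensor K σ) (oneSliceTensor K τ) := by
    have h := tensorRestrictsTo_precomp (oneSliceTensor K σ) (id : Unit → Unit) e e
    rwa [show (fun a b c => oneSliceTensor K σ (id a) (e b) (e c)) = oneSliceTensor K τ
      from oneSliceTensor_reindex K e] at h
  have hτσ : TensorRestrictsTo (oneSliceTensor K τ) (oneSliceTensor K σ) := by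
    have h := tensorRestrictsTo_precomp (oneSliceTensor K τ) (id : Unit → Unit) e.symm e.symm
    rwa [show (fun a b c => oneSliceTensor K τ (id a) (e.symm b) (e.symm c)) = oneSliceTensor K σ
      from oneSliceTensor_reindex K e.symm] at h
  exact hF.eq_of_restrictsTo hτσ hστ

omit hF in
/-- `oneSlice σ ⊗ oneSlice τ` is the one-slice tensor on `σ × τ` (up to the trivial first leg). [folklore] -/
theorem kroneckerTensor_oneSliceTensor (σ τ : Type*) [DecidableEq σ] [DecidableEq τ] :
    kroneckerTensor (oneSliceTensor K σ) (oneSliceTensor K τ) =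
      fun (_ : Unit × Unit) x y => oneSliceTensor K (σ × τ) () x y := by
  funext z x y
  simp only [kroneckerTensor_apply, oneSliceTensor_apply, Prod.ext_iff, mul_ite, mul_one, mul_zero]
  split_ifs <;> simp_all

/-- Multiplicativity on one-slice tensors: `F(oneSlice (σ × τ)) = F(oneSlice σ) F(oneSlice τ)`. [folklore] -/
theorem IsUniversalSpectralPoint.oneSlice_prod {σ τ : Type} [Fintype σ] [Fintype τ] [DecidableEq σ]
    [DecidableEq τ] :
    F (oneSliceTensor K (σ × τ)) = F (oneSliceTensor K σ) * F (oneSliceTensor K τ) := by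
  rw [← hF.map_kronecker, kroneckerTensor_oneSliceTensor]
  refine hF.eq_of_restrictsTo ?_ ?_
  · exact tensorRestrictsTo_precomp (fun (_ : Unit × Unit) x y => oneSliceTensor K (σ × τ) () x y)
      (fun _ => ((), ())) id id
  · exact tensorRestrictsTo_precomp (oneSliceTensor K (σ × τ)) (fun _ => ()) id id

/-- The one-slice value function `g(n) = F(⟨1,n,1⟩) = F(oneSlice (Fin n))`. [folklore] -/
def oneSliceValue (F : SpectralMap K) (n : ℕ) : ℝ := F (oneSliceTensor K (Fin n))

omit hF in
/-- Unfolding. [folklore] -/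
theorem oneSliceValue_def (n : ℕ) : oneSliceValue F n = F (oneSliceTensor K (Fin n)) := rfl

/-- `g(ab) = g(a) g(b)`. [folklore] -/
theorem IsUniversalSpectralPoint.oneSliceValue_mul (a b : ℕ) :
    oneSliceValue F (a * b) = oneSliceValue F a * oneSliceValue F b := by
  rw [oneSliceValue_def, oneSliceValue_def, oneSliceValue_def, ← hF.oneSlice_prod,
    hF.oneSlice_congr finProdFinEquiv.symm]

/-- `g(aʲ) = g(a)ʲ`. [folklore] -/
theorem IsUniversalSpectralPoint.oneSliceValue_pow (a j : ℕ) :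
    oneSliceValue F (a ^ j) = oneSliceValue F a ^ j := by
  induction j with
  | zero =>
    rw [pow_zero, pow_zero, oneSliceValue_def]
    have e1 : oneSliceTensor K (Fin 1) = fun (_ : Unit) (x y : Fin 1) => unitTensor K 1 0 x y := by
      funext z x y
      rw [Subsingleton.elim x 0, Subsingleton.elim y 0]
      simp
    have e2 : unitTensor K 1 = fun (_ : Fin 1) (x y : Fin 1) => oneSliceTensor K (Fin 1) () x y := by
      funext z x y
      rw [Subsingleton.elim x 0, Subsingleton.elim y 0, Subsingleton.elim z 0]
      simp
    have h1 : TensorRestrictsTo (unitTensor K 1) (oneSliceTensor K (Fin 1)) := by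
      rw [e1]; exact tensorRestrictsTo_precomp _ _ _ _
    have h2 : TensorRestrictsTo (oneSliceTensor K (Fin 1)) (unitTensor K 1) := by
      conv_rhs => rw [e2]
      exact tensorRestrictsTo_precomp _ _ _ _
    rw [← hF.map_unitTensor_one]
    exact hF.eq_of_restrictsTo h1 h2
  | succ j ih => rw [pow_succ, hF.oneSliceValue_mul, ih, pow_succ]

/-- `g(1) = 1`. [folklore] -/
theorem IsUniversalSpectralPoint.oneSliceValue_one : oneSliceValue F 1 = 1 := by
  simpa using hF.oneSliceValue_pow 2 0

/-- `g` is monotone. [folklore] -/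
theorem IsUniversalSpectralPoint.oneSliceValue_mono {a b : ℕ} (h : a ≤ b) :
    oneSliceValue F a ≤ oneSliceValue F b :=
  hF.mono _ _ (tensorRestrictsTo_oneSliceTensor_of_embedding K (Fin.castLEEmb h))

/-- `g(n) ≤ n` (`R(⟨1,n,1⟩) ≤ n`). [folklore] -/
theorem IsUniversalSpectralPoint.oneSliceValue_le (n : ℕ) : oneSliceValue F n ≤ n := by
  classical
  refine (hF.le_tensorRank _).trans ?_
  have h : tensorRank (oneSliceTensor K (Fin n)) ≤ Fintype.card (Fin n) := by
    refine tensorRank_le_card_of_eq_sum (fun _ _ => (1 : K)) (fun x => Pi.single x 1)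
      (fun x => Pi.single x 1) ?_
    funext z x y
    rw [Finset.sum_apply, Finset.sum_apply, Finset.sum_apply,
      Finset.sum_eq_single x (fun x' _ hx' => by simp [Pi.single_apply, Ne.symm hx']) (by simp)]
    by_cases hxy : x = y
    · subst hxy; simp
    · simp [hxy, Ne.symm hxy]
  simpa using (Nat.cast_le.2 h : (tensorRank (oneSliceTensor K (Fin n)) : ℝ) ≤ _)

/-- `1 ≤ g(n)` for `n ≥ 1`. [folklore] -/
theorem IsUniversalSpectralPoint.one_le_oneSliceValue {n : ℕ} (hn : 1 ≤ n) : 1 ≤ oneSliceValue F n :=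
  hF.oneSliceValue_one ▸ hF.oneSliceValue_mono hn

/-- **The one-slice values collapse**: if `g(T₀) ≤ g(s₀)` for some `1 ≤ s₀ < T₀`, then `g ≡ 1` on
positive integers (`g` is multiplicative and monotone: `g(T₀) = g(s₀) = a`, `a^{j+1} = g(s₀ʲ T₀) ≤
g(T₀ʲ) = aʲ` once `s₀ʲ T₀ ≤ T₀ʲ`; the argument of Alman–Li 2026, Prop. 4.1/4.4 for one direction).
[cite: AlmanLi2026, Prop. 4.1] -/
theorem IsUniversalSpectralPoint.oneSliceValue_eq_one {s₀ T₀ : ℕ} (hs : 1 ≤ s₀) (hlt : s₀ < T₀)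
    (hle : oneSliceValue F T₀ ≤ oneSliceValue F s₀) {n : ℕ} (hn : 1 ≤ n) : oneSliceValue F n = 1 := by
  set a := oneSliceValue F T₀ with ha
  have hsa : oneSliceValue F s₀ = a := le_antisymm (hF.oneSliceValue_mono hlt.le) hle
  have ha1 : 1 ≤ a := hF.one_le_oneSliceValue (hs.trans hlt.le)
  -- `s₀ʲ T₀ ≤ T₀ʲ` for some `j`
  obtain ⟨j, hj⟩ : ∃ j : ℕ, s₀ ^ j * T₀ ≤ T₀ ^ j := by
    have hq : (1 : ℝ) < (T₀ : ℝ) / s₀ := by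
      rw [lt_div_iff₀ (by exact_mod_cast hs)]; simpa using (Nat.cast_lt.2 hlt : (s₀ : ℝ) < T₀)
    obtain ⟨j, hj⟩ := pow_unbounded_of_one_lt (T₀ : ℝ) hq
    refine ⟨j, ?_⟩
    have hs0 : (0 : ℝ) < (s₀ : ℝ) ^ j := by positivity
    have : (T₀ : ℝ) * (s₀ : ℝ) ^ j < ((T₀ : ℝ) / s₀) ^ j * (s₀ : ℝ) ^ j := mul_lt_mul_of_pos_right hj hs0
    rw [div_pow, div_mul_cancel₀ _ hs0.ne', mul_comm] at this
    exact_mod_cast this.le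
  have hmono := hF.oneSliceValue_mono hj
  rw [hF.oneSliceValue_mul, hF.oneSliceValue_pow, hF.oneSliceValue_pow, hsa] at hmono
  -- `a^j · a ≤ a^j`, so `a ≤ 1`
  have hale : a ≤ 1 := by
    have hpos : 0 < a ^ j := pow_pos (lt_of_lt_of_le one_pos ha1) j
    nlinarith
  have haone : a = 1 := le_antisymm hale ha1
  -- any `n` is below some power of `T₀ ≥ 2`
  have hT : 1 < T₀ := lt_of_le_of_lt hs hlt
  have hnT : n ≤ T₀ ^ n := (Nat.lt_pow_self hT).le
  refine le_antisymm ?_ (hF.one_le_oneSliceValue hn)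
  calc oneSliceValue F n ≤ oneSliceValue F (T₀ ^ n) := hF.oneSliceValue_mono hnT
    _ = a ^ n := hF.oneSliceValue_pow T₀ n
    _ = 1 := by rw [haone, one_pow]

omit hF in
/-- `⟨a,b,c⟩ ≤ ⟨a,1,c⟩ ⊗ oneSlice(Fin b)` (split the middle index off into a one-slice tensor). [folklore] -/
theorem tensorRestrictsTo_kronecker_matMulTensor_oneSlice (a b c : ℕ) :
    TensorRestrictsTo (kroneckerTensor (matMulTensor K a 1 c) (oneSliceTensor K (Fin b))) (matMulTensor K a b c) := by
  have e : matMulTensor K a b c = fun (z : Fin a × Fin c) (x : Fin a × Fin b) (y : Fin b × Fin c) =>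
      kroneckerTensor (matMulTensor K a 1 c) (oneSliceTensor K (Fin b)) (z, ()) ((x.1, 0), x.2) ((0, y.2), y.1) := by
    funext z x y
    simp only [kroneckerTensor_apply, matMulTensor, oneSliceTensor_apply, true_and, mul_ite, mul_one, mul_zero]
    by_cases h1 : z.1 = x.1 <;> by_cases h2 : x.2 = y.1 <;> by_cases h3 : z.2 = y.2 <;> simp [h1, h2, h3]
  rw [e]
  exact tensorRestrictsTo_precomp _ _ _ _

/-- If `g ≡ 1` on positive integers then `F(⟨a,b,c⟩) ≤ ac` for `b ≥ 1`. [cite: AlmanLi2026, Prop. 4.4] -/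
theorem IsUniversalSpectralPoint.matMulTensor_le_of_oneSliceValue_eq_one
    (hg : ∀ n, 1 ≤ n → oneSliceValue F n = 1) {a b c : ℕ} (hb : 1 ≤ b) :
    F (matMulTensor K a b c) ≤ a * c := by
  calc F (matMulTensor K a b c)
      ≤ F (kroneckerTensor (matMulTensor K a 1 c) (oneSliceTensor K (Fin b))) :=
        hF.mono _ _ (tensorRestrictsTo_kronecker_matMulTensor_oneSlice a b c)
    _ = F (matMulTensor K a 1 c) := by
        rw [hF.map_kronecker, show F (oneSliceTensor K (Fin b)) = oneSliceValue F b from rfl, hg b hb,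
          mul_one]
    _ ≤ tensorRank (matMulTensor K a 1 c) := hF.le_tensorRank _
    _ ≤ a * c := by exact_mod_cast (tensorRank_matMulTensor_le (K := K) a 1 c).trans (by simp)

end OneSliceValues

/-! ## Words and products of direct sums of matrix tensors are restrictions of Kronecker powers/products -/

section Words

variable (K : Type u) [CommSemiring K] {p p' : ℕ}

/-- **The direct sum over words is a restriction of the tensor power** `D^{⊗N}`, `D = ⊕ᵢ⟨kᵢ,mᵢ,nᵢ⟩`
(the identity behind `tensorRank_matMulDirectSum_words_le` of `SchoenhageTauDischarge.lean`, exported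
as a restriction so that it also bounds border ranks and spectral values).
[cite: Blaser2013, Thm. 7.5 (proof)] -/
theorem tensorRestrictsTo_kroneckerPow_matMulDirectSum_words (k m n : Fin p → ℕ) (N : ℕ) :
    TensorRestrictsTo (kroneckerPow (matMulDirectSum K k m n) N)
      (matMulDirectSum K
        (fun w : Fin (p ^ N) => ∏ j, k (finFunctionFinEquiv.symm w j))
        (fun w => ∏ j, m (finFunctionFinEquiv.symm w j))
        (fun w => ∏ j, n (finFunctionFinEquiv.symm w j))) := by
  classical
  have hinj : Function.Injective
      (fun w : Fin (p ^ N) => (finFunctionFinEquiv.symm w : Fin N → Fin p)) :=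
    finFunctionFinEquiv.symm.injective
  obtain ⟨eK, -⟩ : ∃ _e : ∀ w : Fin (p ^ N), Fin (∏ j, k (finFunctionFinEquiv.symm w j)) ≃
      (∀ j : Fin N, Fin (k (finFunctionFinEquiv.symm w j))), True :=
    ⟨fun w => (Fintype.equivFinOfCardEq ((Fintype.card_pi
      (α := fun j => Fin (k (finFunctionFinEquiv.symm w j)))).trans
      (by simp only [Fintype.card_fin]))).symm, trivial⟩
  obtain ⟨eM, -⟩ : ∃ _e : ∀ w : Fin (p ^ N), Fin (∏ j, m (finFunctionFinEquiv.symm w j)) ≃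
      (∀ j : Fin N, Fin (m (finFunctionFinEquiv.symm w j))), True :=
    ⟨fun w => (Fintype.equivFinOfCardEq ((Fintype.card_pi
      (α := fun j => Fin (m (finFunctionFinEquiv.symm w j)))).trans
      (by simp only [Fintype.card_fin]))).symm, trivial⟩
  obtain ⟨eN, -⟩ : ∃ _e : ∀ w : Fin (p ^ N), Fin (∏ j, n (finFunctionFinEquiv.symm w j)) ≃
      (∀ j : Fin N, Fin (n (finFunctionFinEquiv.symm w j))), True :=
    ⟨fun w => (Fintype.equivFinOfCardEq ((Fintype.card_pi
      (α := fun j => Fin (n (finFunctionFinEquiv.symm w j)))).trans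
      (by simp only [Fintype.card_fin]))).symm, trivial⟩
  have key : matMulDirectSum K
        (fun w : Fin (p ^ N) => ∏ j, k (finFunctionFinEquiv.symm w j))
        (fun w => ∏ j, m (finFunctionFinEquiv.symm w j))
        (fun w => ∏ j, n (finFunctionFinEquiv.symm w j)) = fun a b c =>
      kroneckerPow (matMulDirectSum K k m n) N
        (fun j => ⟨finFunctionFinEquiv.symm a.1 j, (eK a.1 a.2.1 j, eN a.1 a.2.2 j)⟩)
        (fun j => ⟨finFunctionFinEquiv.symm b.1 j, (eK b.1 b.2.1 j, eM b.1 b.2.2 j)⟩)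
        (fun j => ⟨finFunctionFinEquiv.symm c.1 j, (eM c.1 c.2.1 j, eN c.1 c.2.2 j)⟩) := by
    funext a b c
    obtain ⟨w₁, κ, ν⟩ := a
    obtain ⟨w₂, κ', μ'⟩ := b
    obtain ⟨w₃, μ'', ν''⟩ := c
    simp only [matMulDirectSum, kroneckerPow_apply]
    rw [Fintype.prod_boole]
    refine ite_congr_prop ?_
    constructor
    · rintro ⟨h12, h23, hκ, hμ, hν⟩ j
      subst h12
      subst h23
      obtain rfl : κ = κ' := Fin.ext hκ
      obtain rfl : μ' = μ'' := Fin.ext hμ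
      obtain rfl : ν = ν'' := Fin.ext hν
      exact ⟨rfl, rfl, rfl, rfl, rfl⟩
    · intro H
      have h12 : w₁ = w₂ := hinj (funext fun j => (H j).1)
      subst h12
      have h13 : w₁ = w₃ := hinj (funext fun j => (H j).2.1)
      subst h13
      refine ⟨rfl, rfl, ?_, ?_, ?_⟩
      · rw [(eK w₁).injective (funext fun j => Fin.ext (H j).2.2.1)]
      · rw [(eM w₁).injective (funext fun j => Fin.ext (H j).2.2.2.1)]
      · rw [(eN w₁).injective (funext fun j => Fin.ext (H j).2.2.2.2)]
  rw [key]
  exact tensorRestrictsTo_precomp _ _ _ _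

/-- **The product of two direct sums of matrix tensors contains the direct sum of the products**:
`(⊕ᵢ⟨kᵢ,mᵢ,nᵢ⟩) ⊗ (⊕ⱼ⟨k'ⱼ,m'ⱼ,n'ⱼ⟩) ≥ ⊕_{(i,j)} ⟨kᵢk'ⱼ, mᵢm'ⱼ, nᵢn'ⱼ⟩` (blocks indexed by
`Fin (p p') ≅ Fin p × Fin p'`; Bläser 2013, proof of Thm. 7.5: "the tensors form a ring").
[cite: Blaser2013, Thm. 7.5 (proof)] -/
theorem tensorRestrictsTo_kronecker_matMulDirectSum_prod (k m n : Fin p → ℕ) (k' m' n' : Fin p' → ℕ) :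
    TensorRestrictsTo (kroneckerTensor (matMulDirectSum K k m n) (matMulDirectSum K k' m' n'))
      (matMulDirectSum K
        (fun x : Fin (p * p') => k (finProdFinEquiv.symm x).1 * k' (finProdFinEquiv.symm x).2)
        (fun x => m (finProdFinEquiv.symm x).1 * m' (finProdFinEquiv.symm x).2)
        (fun x => n (finProdFinEquiv.symm x).1 * n' (finProdFinEquiv.symm x).2)) := by
  classical
  set e : Fin (p * p') ≃ Fin p × Fin p' := finProdFinEquiv.symm with he
  have key : matMulDirectSum K
        (fun x : Fin (p * p') => k (e x).1 * k' (e x).2)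
        (fun x => m (e x).1 * m' (e x).2)
        (fun x => n (e x).1 * n' (e x).2) = fun a b c =>
      kroneckerTensor (matMulDirectSum K k m n) (matMulDirectSum K k' m' n')
        (⟨(e a.1).1, ((finProdFinEquiv.symm a.2.1).1, (finProdFinEquiv.symm a.2.2).1)⟩,
          ⟨(e a.1).2, ((finProdFinEquiv.symm a.2.1).2, (finProdFinEquiv.symm a.2.2).2)⟩)
        (⟨(e b.1).1, ((finProdFinEquiv.symm b.2.1).1, (finProdFinEquiv.symm b.2.2).1)⟩,
          ⟨(e b.1).2, ((finProdFinEquiv.symm b.2.1).2, (finProdFinEquiv.symm b.2.2).2)⟩)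
        (⟨(e c.1).1, ((finProdFinEquiv.symm c.2.1).1, (finProdFinEquiv.symm c.2.2).1)⟩,
          ⟨(e c.1).2, ((finProdFinEquiv.symm c.2.1).2, (finProdFinEquiv.symm c.2.2).2)⟩) := by
    funext a b c
    obtain ⟨x₁, κ, ν⟩ := a
    obtain ⟨x₂, κ', μ'⟩ := b
    obtain ⟨x₃, μ'', ν''⟩ := c
    simp only [matMulDirectSum, kroneckerTensor_apply]
    rw [boole_mul, ← ite_and]
    refine ite_congr_prop ⟨?_, ?_⟩
    · rintro ⟨h12, h23, hκ, hμ, hν⟩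
      subst h12
      subst h23
      obtain rfl : κ = κ' := Fin.ext hκ
      obtain rfl : μ' = μ'' := Fin.ext hμ
      obtain rfl : ν = ν'' := Fin.ext hν
      exact ⟨⟨rfl, rfl, rfl, rfl, rfl⟩, ⟨rfl, rfl, rfl, rfl, rfl⟩⟩
    · rintro ⟨⟨a12, a23, aκ, aμ, aν⟩, ⟨b12, b23, bκ, bμ, bν⟩⟩
      have h12 : x₁ = x₂ := e.injective (Prod.ext a12 b12)
      subst h12
      have h13 : x₁ = x₃ := e.injective (Prod.ext a23 b23)
      subst h13
      refine ⟨rfl, rfl, ?_, ?_, ?_⟩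
      · rw [finProdFinEquiv.symm.injective (Prod.ext (Fin.ext aκ) (Fin.ext bκ))]
      · rw [finProdFinEquiv.symm.injective (Prod.ext (Fin.ext aμ) (Fin.ext bμ))]
      · rw [finProdFinEquiv.symm.injective (Prod.ext (Fin.ext aν) (Fin.ext bν))]
  rw [key]
  exact tensorRestrictsTo_precomp _ _ _ _

/-- `∑_x f(first letter of x) g(second letter) = (∑ f)(∑ g)` over `Fin (p p') ≅ Fin p × Fin p'`. [folklore] -/
theorem sum_prodFormat {M : Type*} [CommSemiring M] (f : Fin p → M) (g : Fin p' → M) :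
    (∑ x : Fin (p * p'), f (finProdFinEquiv.symm x).1 * g (finProdFinEquiv.symm x).2) =
      (∑ i, f i) * ∑ j, g j := by
  rw [Finset.sum_mul_sum, ← Fintype.sum_prod_type']
  exact Fintype.sum_equiv finProdFinEquiv.symm _ _ fun x => rfl

/-- `∑_w ∏ⱼ f(wⱼ) = (∑ f)^N` over words `w ∈ [p]^N ≅ Fin (p^N)`. [folklore] -/
theorem sum_words_prod {M : Type*} [CommSemiring M] (f : Fin p → M) (N : ℕ) :
    (∑ w : Fin (p ^ N), ∏ j, f (finFunctionFinEquiv.symm w j)) = (∑ i, f i) ^ N := by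
  rw [Fintype.sum_pow]
  exact Fintype.sum_equiv finFunctionFinEquiv.symm _ _ fun w => rfl

end Words

/-! ## `S(D) ≤ R̃(D)` and subadditivity of spectral points over blocks -/

section Values

variable (K : Type u) [Field K] {p : ℕ}

/-- **`∑ᵢ (kᵢmᵢnᵢ)^{ω/3} ≤ R̃(⊕ᵢ⟨kᵢ,mᵢ,nᵢ⟩)`**: the `τ`-theorem for the rank applied to the words of
length `N` (`S(D)^N = S(words_N) ≤ R(words_N) ≤ R(D^{⊗N})`), and `R̃(D) = inf_N R(D^{⊗N})^{1/N}`
(Strassen: for direct sums of matrix tensors the asymptotic rank dominates `∑ (kmn)^{ω/3}`).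
[cite: Blaser2013, Thm. 7.5] -/
theorem sum_rpow_le_asymptoticRank_matMulDirectSum (k m n : Fin p → ℕ) :
    ∑ i, ((k i * m i * n i : ℕ) : ℝ) ^ (omega K / 3) ≤ asymptoticRank (matMulDirectSum K k m n) := by
  classical
  set S : ℝ := ∑ i, ((k i * m i * n i : ℕ) : ℝ) ^ (omega K / 3) with hS
  have hS0 : 0 ≤ S := Finset.sum_nonneg fun i _ => by positivity
  refine le_ciInf fun N => ?_
  have hW := asymptoticSumInequality_rank K
    (fun w : Fin (p ^ (N + 1)) => ∏ j, k (finFunctionFinEquiv.symm w j))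
    (fun w => ∏ j, m (finFunctionFinEquiv.symm w j))
    (fun w => ∏ j, n (finFunctionFinEquiv.symm w j))
    ((tensorRestrictsTo_kroneckerPow_matMulDirectSum_words K k m n (N + 1)).tensorRank_le)
  rw [sum_words_rpow k m n (N + 1)] at hW
  -- `S^{N+1} ≤ R(D^{⊗(N+1)})`, take `(N+1)`-th roots
  have h := Real.rpow_le_rpow (pow_nonneg hS0 (N + 1)) hW (by positivity : (0 : ℝ) ≤ ((N : ℝ) + 1)⁻¹)
  rwa [← Real.rpow_natCast, ← Real.rpow_mul hS0, show ((N + 1 : ℕ) : ℝ) * ((N : ℝ) + 1)⁻¹ = 1 by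
    push_cast; field_simp, Real.rpow_one] at h

/-- Peeling off the first block: `⊕_{i < q+1} ⟨kᵢ,mᵢ,nᵢ⟩ ≤ ⟨k₀,m₀,n₀⟩ ⊕ ⊕_{i < q} ⟨k_{i+1}, …⟩`
(a relabelling of index types). [folklore] -/
theorem tensorRestrictsTo_directSum_matMulDirectSum_succ {q : ℕ} (k m n : Fin (q + 1) → ℕ) :
    TensorRestrictsTo (directSumTensor (matMulTensor K (k 0) (m 0) (n 0))
        (matMulDirectSum K (fun i => k i.succ) (fun i => m i.succ) (fun i => n i.succ)))
      (matMulDirectSum K k m n) := by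
  classical
  -- index maps, by cases on the block index
  let fZ : (Σ i : Fin (q + 1), Fin (k i) × Fin (n i)) →
      (Fin (k 0) × Fin (n 0)) ⊕ (Σ i : Fin q, Fin (k i.succ) × Fin (n i.succ)) :=
    fun a => Fin.cases (motive := fun i => Fin (k i) × Fin (n i) → _) (fun pr => Sum.inl pr)
      (fun j pr => Sum.inr ⟨j, pr⟩) a.1 a.2
  let fX : (Σ i : Fin (q + 1), Fin (k i) × Fin (m i)) →
      (Fin (k 0) × Fin (m 0)) ⊕ (Σ i : Fin q, Fin (k i.succ) × Fin (m i.succ)) :=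
    fun a => Fin.cases (motive := fun i => Fin (k i) × Fin (m i) → _) (fun pr => Sum.inl pr)
      (fun j pr => Sum.inr ⟨j, pr⟩) a.1 a.2
  let fY : (Σ i : Fin (q + 1), Fin (m i) × Fin (n i)) →
      (Fin (m 0) × Fin (n 0)) ⊕ (Σ i : Fin q, Fin (m i.succ) × Fin (n i.succ)) :=
    fun a => Fin.cases (motive := fun i => Fin (m i) × Fin (n i) → _) (fun pr => Sum.inl pr)
      (fun j pr => Sum.inr ⟨j, pr⟩) a.1 a.2
  have key : matMulDirectSum K k m n = fun a b c =>
      directSumTensor (matMulTensor K (k 0) (m 0) (n 0))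
        (matMulDirectSum K (fun i => k i.succ) (fun i => m i.succ) (fun i => n i.succ))
        (fZ a) (fX b) (fY c) := by
    funext a b c
    obtain ⟨i, pa⟩ := a
    obtain ⟨i', pb⟩ := b
    obtain ⟨i'', pc⟩ := c
    refine Fin.cases ?_ (fun j => ?_) i pa <;> refine Fin.cases ?_ (fun j' => ?_) i' pb <;>
      refine Fin.cases ?_ (fun j'' => ?_) i'' pc <;> intro pc pb pa
    · simp [fZ, fX, fY, matMulDirectSum, matMulTensor, directSumTensor, Fin.ext_iff]
    · simp [fZ, fX, fY, matMulDirectSum, directSumTensor, (Fin.succ_ne_zero j'').symm]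
    · simp [fZ, fX, fY, matMulDirectSum, directSumTensor, (Fin.succ_ne_zero j').symm]
    · simp [fZ, fX, fY, matMulDirectSum, directSumTensor, (Fin.succ_ne_zero j').symm]
    · simp [fZ, fX, fY, matMulDirectSum, directSumTensor, Fin.succ_ne_zero j]
    · simp [fZ, fX, fY, matMulDirectSum, directSumTensor, Fin.succ_ne_zero j]
    · simp [fZ, fX, fY, matMulDirectSum, directSumTensor]
    · simp [fZ, fX, fY, matMulDirectSum, directSumTensor, Fin.succ_inj]
  rw [key]
  exact tensorRestrictsTo_precomp _ _ _ _

variable {K}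

/-- **Subadditivity of a universal spectral point over the blocks of a direct sum of matrix tensors**:
`F(⊕ᵢ⟨kᵢ,mᵢ,nᵢ⟩) ≤ ∑ᵢ F(⟨kᵢ,mᵢ,nᵢ⟩)` (peel the blocks off one at a time; in fact equality holds).
[cite: ChristandlVranaZuiddam2023, §1.2] -/
theorem IsUniversalSpectralPoint.matMulDirectSum_le_sum {F : SpectralMap K} (hF : IsUniversalSpectralPoint K F) :
    ∀ {q : ℕ} (k m n : Fin q → ℕ),
      F (matMulDirectSum K k m n) ≤ ∑ i, F (matMulTensor K (k i) (m i) (n i)) := by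
  intro q
  induction q with
  | zero =>
    intro k m n
    have h0 : matMulDirectSum K k m n = 0 := by
      funext a; exact (IsEmpty.false a.1).elim
    rw [h0, hF.map_zero]
    simp
  | succ q ih =>
    intro k m n
    calc F (matMulDirectSum K k m n)
        ≤ F (directSumTensor (matMulTensor K (k 0) (m 0) (n 0))
            (matMulDirectSum K (fun i => k i.succ) (fun i => m i.succ) (fun i => n i.succ))) :=
          hF.mono _ _ (tensorRestrictsTo_directSum_matMulDirectSum_succ K k m n)
      _ = F (matMulTensor K (k 0) (m 0) (n 0)) +
            F (matMulDirectSum K (fun i => k i.succ) (fun i => m i.succ) (fun i => n i.succ)) :=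
          hF.map_directSum _ _
      _ ≤ F (matMulTensor K (k 0) (m 0) (n 0)) + ∑ i : Fin q, F (matMulTensor K (k i.succ) (m i.succ) (n i.succ)) :=
          add_le_add le_rfl (ih _ _ _)
      _ = ∑ i, F (matMulTensor K (k i) (m i) (n i)) :=
          (Fin.sum_univ_succ fun i => F (matMulTensor K (k i) (m i) (n i))).symm

end Values

/-! ## The engine: a tight direct sum with all three dimensions below its border rank is impossible -/

section Engine

variable (K : Type u) [Field K]

/-- Local copy: a universal spectral point takes the value `n` at `⟨n⟩`. [cite: ChristandlVranaZuiddam2023, §1.2] -/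
private theorem map_unitTensor_natCast'' {F : SpectralMap K} (hF : IsUniversalSpectralPoint K F) (n : ℕ) :
    F (unitTensor K n) = n := by
  rw [← TensorClass.evalRingHom_mk hF, ← TensorClass.natCast_eq_mk, map_natCast]

/-- **Engine of the strict asymptotic sum inequality.** A direct sum `𝐃 = ⊕ᵢ⟨kᵢ,mᵢ,nᵢ⟩` of positive
formats which is *tight* (`∑ (kᵢmᵢnᵢ)^{ω/3} = bR(𝐃) =: ρ`) cannot have all three dimensions
`∑kᵢnᵢ, ∑kᵢmᵢ, ∑mᵢnᵢ` strictly below `ρ`: otherwise, for the direct sum `𝐓` of the words of length `N`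
(`N` large), the one-slice speedup `𝐓 ⊕ ⟨1,ρᴺ,1⟩ ⊴ ⟨ρᴺ⟩ ⊕ ⟨1,d_κᴺ+d_μᴺ,1⟩` and a universal spectral point
`F` with `F(𝐓) = R̃(𝐓) = ρᴺ` (Strassen duality) force `F(⟨1,n,1⟩) = 1` for all `n`, whence
`ρᴺ = F(𝐓) ≤ ∑_w K_w N_w = d_ιᴺ < ρᴺ` (Alman–Li 2026, Thm. 6.1 / Cor. 6.1, via Strassen calculus; Strassen
1988). [cite: AlmanLi2026, Cor. 6.1] -/
theorem false_of_sum_rpow_eq_algBorderRank {q : ℕ} (k m n : Fin q → ℕ)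
    (hpos : ∀ i, 1 ≤ k i ∧ 1 ≤ m i ∧ 1 ≤ n i)
    (hS : ∑ i, ((k i * m i * n i : ℕ) : ℝ) ^ (omega K / 3) = algBorderRank (matMulDirectSum K k m n))
    (hι : ∑ i, k i * n i < algBorderRank (matMulDirectSum K k m n))
    (hκ : ∑ i, k i * m i < algBorderRank (matMulDirectSum K k m n))
    (hμ : ∑ i, m i * n i < algBorderRank (matMulDirectSum K k m n)) : False := by
  classical
  set D := matMulDirectSum K k m n with hD
  set ρ : ℕ := algBorderRank D with hρ
  -- `q ≥ 1`
  have hq : 0 < q := by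
    rcases Nat.eq_zero_or_pos q with h0 | h0
    · subst h0
      have h1 : (ρ : ℝ) = 0 := by rw [← hS]; simp
      have h2 : ρ = 0 := by exact_mod_cast h1
      rw [h2] at hι
      exact absurd hι (by simp)
    · exact h0
  set i₀ : Fin q := ⟨0, hq⟩
  -- the largest dimension `d`, `1 ≤ d < ρ`
  set dι := ∑ i, k i * n i with hdι
  set dκ := ∑ i, k i * m i with hdκ
  set dμ := ∑ i, m i * n i with hdμ
  set d := max dι (max dκ dμ) with hd
  have hdρ : d < ρ := by simp [hd, hι, hκ, hμ]
  have hdι1 : 1 ≤ dι := le_trans (Nat.mul_pos (hpos i₀).1 (hpos i₀).2.2)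
    (Finset.single_le_sum (f := fun i => k i * n i) (fun i _ => Nat.zero_le _) (Finset.mem_univ i₀))
  have hdκ1 : 1 ≤ dκ := le_trans (Nat.mul_pos (hpos i₀).1 (hpos i₀).2.1)
    (Finset.single_le_sum (f := fun i => k i * m i) (fun i _ => Nat.zero_le _) (Finset.mem_univ i₀))
  have hd1 : 1 ≤ d := hdι1.trans (le_max_left _ _)
  -- choose `N` with `2 dᴺ < ρᴺ`
  obtain ⟨N, hN⟩ : ∃ N : ℕ, 2 * (d : ℝ) ^ N < (ρ : ℝ) ^ N := by
    have hdpos : (0 : ℝ) < d := by exact_mod_cast hd1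
    have h1 : (1 : ℝ) < (ρ : ℝ) / d := by
      rw [lt_div_iff₀ hdpos, one_mul]; exact_mod_cast hdρ
    obtain ⟨N, hN⟩ := pow_unbounded_of_one_lt (2 : ℝ) h1
    refine ⟨N, ?_⟩
    have h2 := mul_lt_mul_of_pos_right hN (pow_pos hdpos N)
    rwa [div_pow, div_mul_cancel₀ _ (pow_pos hdpos N).ne'] at h2
  have hpowle : ∀ {a : ℕ}, a ≤ d → (a : ℝ) ^ N ≤ (d : ℝ) ^ N := fun h =>
    pow_le_pow_left₀ (Nat.cast_nonneg _) (by exact_mod_cast h) N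
  have hNκμ : dκ ^ N + dμ ^ N < ρ ^ N := by
    have h1 := hpowle (show dκ ≤ d by simp [hd])
    have h2 := hpowle (show dμ ≤ d by simp [hd])
    have h3 : ((dκ ^ N + dμ ^ N : ℕ) : ℝ) < ((ρ ^ N : ℕ) : ℝ) := by push_cast; linarith
    exact_mod_cast h3
  have hNι : dι ^ N < ρ ^ N := by
    have h1 := hpowle (show dι ≤ d by simp [hd])
    have h0 : (0 : ℝ) ≤ (d : ℝ) ^ N := by positivity
    have h3 : ((dι ^ N : ℕ) : ℝ) < ((ρ ^ N : ℕ) : ℝ) := by push_cast; linarith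
    exact_mod_cast h3
  -- the direct sum `T` of the words of length `N`
  set kN : Fin (q ^ N) → ℕ := fun w => ∏ j, k (finFunctionFinEquiv.symm w j) with hkN
  set mN : Fin (q ^ N) → ℕ := fun w => ∏ j, m (finFunctionFinEquiv.symm w j) with hmN
  set nN : Fin (q ^ N) → ℕ := fun w => ∏ j, n (finFunctionFinEquiv.symm w j) with hnN
  set T := matMulDirectSum K kN mN nN with hT
  have hposN : ∀ w, 1 ≤ kN w ∧ 1 ≤ mN w ∧ 1 ≤ nN w := fun w =>
    ⟨Nat.succ_le_of_lt (Finset.prod_pos fun j _ => (hpos (finFunctionFinEquiv.symm w j)).1),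
      Nat.succ_le_of_lt (Finset.prod_pos fun j _ => (hpos (finFunctionFinEquiv.symm w j)).2.1),
      Nat.succ_le_of_lt (Finset.prod_pos fun j _ => (hpos (finFunctionFinEquiv.symm w j)).2.2)⟩
  -- `bR(T) = S(T) = ρᴺ`
  have hT_le : algBorderRank T ≤ ρ ^ N :=
    ((tensorRestrictsTo_kroneckerPow_matMulDirectSum_words K k m n N).algBorderRank_le).trans
      (algBorderRank_kroneckerPow_le D N)
  have hST : ∑ w, ((kN w * mN w * nN w : ℕ) : ℝ) ^ (omega K / 3) = (ρ : ℝ) ^ N := by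
    rw [← hS]
    exact sum_words_rpow k m n N (omega K / 3)
  have hT_ge : ρ ^ N ≤ algBorderRank T := by
    have h := asymptoticSumInequality_algBorderRank K kN mN nN (le_refl (algBorderRank T))
    rw [hST] at h
    exact_mod_cast h
  have hT_eq : algBorderRank T = ρ ^ N := le_antisymm hT_le hT_ge
  -- dimensions of `T`
  have hdimι : ∑ w, kN w * nN w = dι ^ N := by
    rw [hdι, ← sum_words_prod (fun i => k i * n i) N]
    exact Finset.sum_congr rfl fun w _ => by
      simp only [hkN, hnN]; rw [← Finset.prod_mul_distrib]
  have hdimκ : ∑ w, kN w * mN w = dκ ^ N := by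
    rw [hdκ, ← sum_words_prod (fun i => k i * m i) N]
    exact Finset.sum_congr rfl fun w _ => by
      simp only [hkN, hmN]; rw [← Finset.prod_mul_distrib]
  have hdimμ : ∑ w, mN w * nN w = dμ ^ N := by
    rw [hdμ, ← sum_words_prod (fun i => m i * n i) N]
    exact Finset.sum_congr rfl fun w _ => by
      simp only [hmN, hnN]; rw [← Finset.prod_mul_distrib]
  have hcard : Fintype.card ((Σ w, Fin (kN w) × Fin (mN w)) ⊕ (Σ w, Fin (mN w) × Fin (nN w))) =
      dκ ^ N + dμ ^ N := by
    simp only [Fintype.card_sum, Fintype.card_sigma, Fintype.card_prod, Fintype.card_fin, hdimκ, hdimμ]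
  -- the one-slice speedup and a maximising universal spectral point
  have hdeg := algDegeneratesTo_oneSliceSpeedup (K := K) T
  obtain ⟨F, hF, hFT⟩ := (strassen_duality_asymptoticRank_holds K T).2
  have hF_le : F T ≤ (ρ : ℝ) ^ N := by
    have h := hF.le_of_algBorderRank_le T hT_le
    exact_mod_cast h
  have hF_ge : (ρ : ℝ) ^ N ≤ F T := by
    rw [hFT, ← hST]
    exact sum_rpow_le_asymptoticRank_matMulDirectSum K kN mN nN
  have hF_eq : F T = (ρ : ℝ) ^ N := le_antisymm hF_le hF_ge
  have hmono := hF.mono_of_algDegeneratesTo hdeg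
  rw [hF.map_directSum, hF.map_directSum, map_unitTensor_natCast'' K hF, hT_eq, hF_eq,
    hF.oneSlice_congr (Fintype.equivFinOfCardEq hcard).symm] at hmono
  push_cast at hmono
  -- `g(ρᴺ) ≤ g(d_κᴺ + d_μᴺ)`, so `g ≡ 1`
  have hg_le : oneSliceValue F (ρ ^ N) ≤ oneSliceValue F (dκ ^ N + dμ ^ N) := by
    rw [oneSliceValue_def, oneSliceValue_def]; linarith
  have hs1 : 1 ≤ dκ ^ N + dμ ^ N := le_add_right (Nat.one_le_pow _ _ hdκ1)
  have hg : ∀ n, 1 ≤ n → oneSliceValue F n = 1 := fun n hn =>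
    hF.oneSliceValue_eq_one hs1 hNκμ hg_le hn
  -- hence `F(T) ≤ ∑_w K_w N_w = d_ιᴺ < ρᴺ = F(T)`
  have hsum : F T ≤ ((dι ^ N : ℕ) : ℝ) := by
    calc F T ≤ ∑ w, F (matMulTensor K (kN w) (mN w) (nN w)) := hF.matMulDirectSum_le_sum kN mN nN
      _ ≤ ∑ w, ((kN w * nN w : ℕ) : ℝ) := Finset.sum_le_sum fun w _ => by
          have h := hF.matMulTensor_le_of_oneSliceValue_eq_one hg (hposN w).2.1 (a := kN w) (c := nN w)
          exact_mod_cast h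
      _ = ((dι ^ N : ℕ) : ℝ) := by rw [← hdimι]; push_cast; rfl
  have : ((dι ^ N : ℕ) : ℝ) < ((ρ ^ N : ℕ) : ℝ) := by exact_mod_cast hNι
  rw [hF_eq] at hsum
  push_cast at this hsum
  linarith

end Engine

/-! ## Symmetrisation and the main theorem -/

section Main

variable (K : Type u) [Field K] {p p' : ℕ}

/-- Product formats on `Fin (p p') ≅ Fin p × Fin p'`. [folklore] -/
def prodFmt (f : Fin p → ℕ) (g : Fin p' → ℕ) : Fin (p * p') → ℕ :=
  fun x => f (finProdFinEquiv.symm x).1 * g (finProdFinEquiv.symm x).2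

/-- Unfolding. [folklore] -/
@[simp] theorem prodFmt_apply (f : Fin p → ℕ) (g : Fin p' → ℕ) (x : Fin (p * p')) :
    prodFmt f g x = f (finProdFinEquiv.symm x).1 * g (finProdFinEquiv.symm x).2 := rfl

/-- `bR` of the direct sum with product formats is at most the product of the `bR`'s. [cite: Blaser2013, Thm. 7.5 (proof)] -/
theorem algBorderRank_matMulDirectSum_prodFmt_le (k m n : Fin p → ℕ) (k' m' n' : Fin p' → ℕ) :
    algBorderRank (matMulDirectSum K (prodFmt k k') (prodFmt m m') (prodFmt n n')) ≤
      algBorderRank (matMulDirectSum K k m n) * algBorderRank (matMulDirectSum K k' m' n') :=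
  ((tensorRestrictsTo_kronecker_matMulDirectSum_prod K k m n k' m' n').algBorderRank_le).trans
    (algBorderRank_kroneckerTensor_le _ _)

/-- `S` is multiplicative on product formats. [folklore] -/
theorem sum_rpow_prodFmt (k m n : Fin p → ℕ) (k' m' n' : Fin p' → ℕ) (e : ℝ) :
    ∑ x, ((prodFmt k k' x * prodFmt m m' x * prodFmt n n' x : ℕ) : ℝ) ^ e =
      (∑ i, ((k i * m i * n i : ℕ) : ℝ) ^ e) * ∑ j, ((k' j * m' j * n' j : ℕ) : ℝ) ^ e := by
  rw [← sum_prodFormat]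
  refine Finset.sum_congr rfl fun x _ => ?_
  rw [← Real.mul_rpow (by positivity) (by positivity)]
  congr 1
  simp only [prodFmt_apply]
  push_cast
  ring

/-- Dimensions are multiplicative on product formats. [folklore] -/
theorem sum_mul_prodFmt (f g : Fin p → ℕ) (f' g' : Fin p' → ℕ) :
    ∑ x, prodFmt f f' x * prodFmt g g' x = (∑ i, f i * g i) * ∑ j, f' j * g' j := by
  rw [← sum_prodFormat]
  refine Finset.sum_congr rfl fun x _ => ?_
  simp only [prodFmt_apply]
  ring

/-- **Rotation of formats does not increase the border rank**: `bR(⊕⟨mᵢ,nᵢ,kᵢ⟩) ≤ bR(⊕⟨kᵢ,mᵢ,nᵢ⟩)`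
(the first is a relabelling of the rotated tensor; Bläser 2013, Thm. 6.3(1)). [cite: Blaser2013, Thm. 6.3(1)] -/
theorem algBorderRank_matMulDirectSum_rotate_le (k m n : Fin p → ℕ) :
    algBorderRank (matMulDirectSum K m n k) ≤ algBorderRank (matMulDirectSum K k m n) := by
  classical
  have key : matMulDirectSum K m n k = fun a b c =>
      rotate (matMulDirectSum K k m n) (⟨a.1, (a.2.2, a.2.1)⟩ : Σ i, Fin (k i) × Fin (m i))
        (⟨b.1, (b.2.1, b.2.2)⟩ : Σ i, Fin (m i) × Fin (n i))
        (⟨c.1, (c.2.2, c.2.1)⟩ : Σ i, Fin (k i) × Fin (n i)) := by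
    funext a b c
    simp only [matMulDirectSum, rotate_apply]
    refine ite_congr_prop ⟨?_, ?_⟩
    · rintro ⟨h1, h2, h3, h4, h5⟩
      exact ⟨(h1.trans h2).symm, h1, h5.symm, h3, h4.symm⟩
    · rintro ⟨h1, h2, h3, h4, h5⟩
      exact ⟨h2, (h1.trans h2).symm, h4, h5.symm, h3.symm⟩
  rw [key]
  exact (algBorderRank_precomp_le _ _ _ _).trans (algBorderRank_rotate _).le

/-- **The asymptotic sum inequality is strict** ("`ω` is an infimum, not a minimum"; Coppersmith–
Winograd 1982, as reported by Bürgisser–Clausen–Shokrollahi 1997, §15.13 Notes, p. 455, and printed as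
Landsberg 2017, Thm. 3.3.3.5 [CW82]; first established for border-rank bounds by Strassen 1988, cf.
Alman–Li 2026, Cor. 6.1): over any field `K`, for the border rank over `K[ε]`, if every block of
`⊕ᵢ ⟨kᵢ,mᵢ,nᵢ⟩` has positive dimensions and some block is not `⟨1,1,1⟩`, then
`∑ᵢ (kᵢ mᵢ nᵢ)^{ω/3} < bR(⊕ᵢ ⟨kᵢ,mᵢ,nᵢ⟩)`. [cite: BurgisserClausenShokrollahi1997, §15.13 Notes (p. 455)] -/
theorem sum_rpow_omega_div_three_lt_algBorderRank_matMulDirectSum (k m n : Fin p → ℕ)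
    (hpos : ∀ i, 1 ≤ k i ∧ 1 ≤ m i ∧ 1 ≤ n i) (hnt : ∃ i, ¬ (k i = 1 ∧ m i = 1 ∧ n i = 1)) :
    ∑ i, ((k i * m i * n i : ℕ) : ℝ) ^ (omega K / 3) <
      (algBorderRank (matMulDirectSum K k m n) : ℝ) := by
  classical
  set r : ℕ := algBorderRank (matMulDirectSum K k m n) with hr
  set S : ℝ := ∑ i, ((k i * m i * n i : ℕ) : ℝ) ^ (omega K / 3) with hSdef
  have hle : S ≤ r := asymptoticSumInequality_algBorderRank K k m n le_rfl
  refine lt_of_le_of_ne hle fun hS => ?_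
  -- the three dimensions
  set A := ∑ i, k i * m i with hA
  set B := ∑ i, m i * n i with hB
  set C := ∑ i, k i * n i with hC
  have hAr : A ≤ r := sum_mul_le_algBorderRank_matMulDirectSum_left K k m n fun i => (hpos i).2.2
  have hBr : B ≤ r := sum_mul_le_algBorderRank_matMulDirectSum_right K k m n fun i => (hpos i).1
  have hCr : C ≤ r := sum_mul_le_algBorderRank_matMulDirectSum K k m n fun i => (hpos i).2.1
  by_cases hII : r ≤ A ∧ r ≤ B ∧ r ≤ C
  · -- Case II: cubic format of minimal border rank — impossible by CW82 Rem. 6.2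
    obtain ⟨h1, h2, h3⟩ := hII
    have hlt := lt_algBorderRank_matMulDirectSum_of_cubic K k m n hpos hnt (N := r)
      (le_antisymm hAr h1) (le_antisymm hBr h2) (le_antisymm hCr h3)
    exact lt_irrefl _ hlt
  · -- Case I: `ABC < r³`; symmetrise
    have hr0 : 0 < r := by
      obtain ⟨i, -⟩ := hnt
      exact lt_of_lt_of_le (Nat.mul_pos (hpos i).1 (hpos i).2.1)
        ((Finset.single_le_sum (f := fun i => k i * m i) (fun i _ => Nat.zero_le _)
          (Finset.mem_univ i)).trans hAr)
    have hrr : 0 < r * r := Nat.mul_pos hr0 hr0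
    have hABC : A * B * C < r * r * r := by
      rw [not_and_or, not_and_or, not_le, not_le, not_le] at hII
      rcases hII with hA' | hB' | hC'
      · calc A * B * C = A * (B * C) := mul_assoc _ _ _
          _ ≤ A * (r * r) := Nat.mul_le_mul_left A (Nat.mul_le_mul hBr hCr)
          _ < r * (r * r) := mul_lt_mul_of_pos_right hA' hrr
          _ = r * r * r := (mul_assoc _ _ _).symm
      · calc A * B * C = B * (A * C) := by ring
          _ ≤ B * (r * r) := Nat.mul_le_mul_left B (Nat.mul_le_mul hAr hCr)
          _ < r * (r * r) := mul_lt_mul_of_pos_right hB' hrr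
          _ = r * r * r := (mul_assoc _ _ _).symm
      · calc A * B * C = C * (A * B) := by ring
          _ ≤ C * (r * r) := Nat.mul_le_mul_left C (Nat.mul_le_mul hAr hBr)
          _ < r * (r * r) := mul_lt_mul_of_pos_right hC' hrr
          _ = r * r * r := (mul_assoc _ _ _).symm
    -- rotation bounds
    have hrot1 : algBorderRank (matMulDirectSum K m n k) ≤ r := algBorderRank_matMulDirectSum_rotate_le K k m n
    have hrot2 : algBorderRank (matMulDirectSum K n k m) ≤ r :=
      (algBorderRank_matMulDirectSum_rotate_le K m n k).trans hrot1
    -- the symmetrised direct sum `D₃ ≤ (D ⊗ D') ⊗ D''`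
    have hpos₃ : ∀ x, 1 ≤ prodFmt (prodFmt k m) n x ∧ 1 ≤ prodFmt (prodFmt m n) k x ∧
        1 ≤ prodFmt (prodFmt n k) m x := fun x =>
      ⟨Nat.mul_pos (Nat.mul_pos (hpos _).1 (hpos _).2.1) (hpos _).2.2,
        Nat.mul_pos (Nat.mul_pos (hpos _).2.1 (hpos _).2.2) (hpos _).1,
        Nat.mul_pos (Nat.mul_pos (hpos _).2.2 (hpos _).1) (hpos _).2.1⟩
    have hbR₃ : algBorderRank (matMulDirectSum K (prodFmt (prodFmt k m) n) (prodFmt (prodFmt m n) k)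
        (prodFmt (prodFmt n k) m)) ≤ r * r * r :=
      calc _ ≤ algBorderRank (matMulDirectSum K (prodFmt k m) (prodFmt m n) (prodFmt n k)) *
              algBorderRank (matMulDirectSum K n k m) := algBorderRank_matMulDirectSum_prodFmt_le K _ _ _ _ _ _
        _ ≤ (algBorderRank (matMulDirectSum K k m n) * algBorderRank (matMulDirectSum K m n k)) *
              algBorderRank (matMulDirectSum K n k m) :=
            Nat.mul_le_mul_right _ (algBorderRank_matMulDirectSum_prodFmt_le K k m n m n k)
        _ ≤ r * r * r := Nat.mul_le_mul (Nat.mul_le_mul le_rfl hrot1) hrot2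
    -- `S(D₃) = S³ = r³`
    have hS' : ∑ i, ((m i * n i * k i : ℕ) : ℝ) ^ (omega K / 3) = S :=
      Finset.sum_congr rfl fun i _ => by rw [show m i * n i * k i = k i * m i * n i by ring]
    have hS'' : ∑ i, ((n i * k i * m i : ℕ) : ℝ) ^ (omega K / 3) = S :=
      Finset.sum_congr rfl fun i _ => by rw [show n i * k i * m i = k i * m i * n i by ring]
    have hS₃ : ∑ x, ((prodFmt (prodFmt k m) n x * prodFmt (prodFmt m n) k x * prodFmt (prodFmt n k) m x : ℕ) : ℝ) ^
        (omega K / 3) = (r : ℝ) * r * r := by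
      rw [sum_rpow_prodFmt, sum_rpow_prodFmt, hS', hS'', ← hSdef, hS]
    have hASI₃ := asymptoticSumInequality_algBorderRank K (prodFmt (prodFmt k m) n) (prodFmt (prodFmt m n) k)
      (prodFmt (prodFmt n k) m) le_rfl
    have hbR₃_eq : (algBorderRank (matMulDirectSum K (prodFmt (prodFmt k m) n) (prodFmt (prodFmt m n) k)
        (prodFmt (prodFmt n k) m)) : ℝ) = (r : ℝ) * r * r :=
      le_antisymm (by exact_mod_cast hbR₃) (hS₃ ▸ hASI₃)
    have hbR₃_nat : algBorderRank (matMulDirectSum K (prodFmt (prodFmt k m) n) (prodFmt (prodFmt m n) k)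
        (prodFmt (prodFmt n k) m)) = r * r * r := by exact_mod_cast hbR₃_eq
    -- dimensions of `D₃` are `ABC`
    have hA' : ∑ i, m i * k i = A := Finset.sum_congr rfl fun i _ => mul_comm _ _
    have hB' : ∑ i, n i * m i = B := Finset.sum_congr rfl fun i _ => mul_comm _ _
    have hC' : ∑ i, n i * k i = C := Finset.sum_congr rfl fun i _ => mul_comm _ _
    have hdι₃ : ∑ x, prodFmt (prodFmt k m) n x * prodFmt (prodFmt n k) m x = A * B * C := by
      rw [sum_mul_prodFmt, sum_mul_prodFmt, ← hC, hA', hB']; ring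
    have hdκ₃ : ∑ x, prodFmt (prodFmt k m) n x * prodFmt (prodFmt m n) k x = A * B * C := by
      rw [sum_mul_prodFmt, sum_mul_prodFmt, ← hA, ← hB, hC']
    have hdμ₃ : ∑ x, prodFmt (prodFmt m n) k x * prodFmt (prodFmt n k) m x = A * B * C := by
      rw [sum_mul_prodFmt, sum_mul_prodFmt, ← hB, hC', ← hA]; ring
    refine false_of_sum_rpow_eq_algBorderRank K (prodFmt (prodFmt k m) n) (prodFmt (prodFmt m n) k)
      (prodFmt (prodFmt n k) m) hpos₃ (by rw [hS₃, hbR₃_eq]) ?_ ?_ ?_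
    · rw [hdι₃, hbR₃_nat]; exact hABC
    · rw [hdκ₃, hbR₃_nat]; exact hABC
    · rw [hdμ₃, hbR₃_nat]; exact hABC

end Main

end Literature.Computability.AlgebraicComplexity

end
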